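import Summits.AtomisticToContinuum.HydrodynamicLimit.Theorems.OneFlightGossipEngineEquilibriumClampedCollisionalWindowLDDefs
import Summits.AtomisticToContinuum.HydrodynamicLimit.Theorems.OneFlightGossipEngineEquilibriumClampedCollisionalWindowLDStubHoeffdingChain
import Summits.AtomisticToContinuum.HydrodynamicLimit.Theorems.OneFlightGossipEngineEquilibriumClampedCollisionalWindowLDStubAdaptedClampKinematics

/-!
# Line `coarse-coin-entropy-chain`: the repaired crux C′ from its four LD stubs (conditional composition, sorry-free)

Crux `Summit.AtomisticToContinuum.HydrodynamicLimit.Theses.TwoClocks.EquilibriumClampedCollisionalWindowLD` (stmt-AtomisticToContinuum-13733;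
byte-identical copy in `Theses.OneFlightGossipEngine`). Its ENERGY conjunct is refuted on paper (Newton-cradle relay, crux workfile
`Disproof.lean`); the line is the registered skeleton `Cruxes/…/Lines/coarse_coin_entropy_chain.lean` of the REPAIRED statement
C′ = `ClampedTransferWindowLD` (the filed text with the one change `act i := (σ/τ)·collisionSum (Ioc 0 w) [c.fst = i] (‖Δv‖ + |‖v⁺‖²−‖v⁻‖²|/2)`,
the transfer-activity clamp — typed VERBATIM below). This file is the line's COMPOSITION moved into the tree: with the two provable
stubs LANDED — S1 `stub_predictableHoeffdingChain` (predictable-range Hoeffding chain) and S2 `stub_adaptedClampKinematics` (pathwise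
clamp kinematics), both imported — the four large-deviation stubs S3–S6, which are OPEN fixed-density kinetic-window statements, are
packaged as named hypotheses (`ActivityOverflowLD`, `CoinBudgetLD`, `CompensatorDefectLD`, `RateWindowLD`: the registered signatures
verbatim), and `clampedTransferWindowLD_of_LD : ActivityOverflowLD → CoinBudgetLD → CompensatorDefectLD → RateWindowLD → ClampedTransferWindowLD`
is kernel-checked (per row: the four-way split `β w⁻¹(X − A) = β w⁻¹(X − X̃) + β w⁻¹ M_H + β w⁻¹(X̃ − M_H − K_exp) + β w⁻¹(K_exp − A)`,
exponential convexity at tilt 4; S2a+S3, S1+S2bc+S4 along S5's filtration, S5, S6). CONDITIONAL: it closes nothing by itself; it records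
exactly what the restated crux C′ still needs. (The by-name anchor `crux_le_momentumRows` lives in the crux workfile; nothing here is claimed about the filed decl.)
-/

noncomputable section

open MeasureTheory ProbabilityTheory Set Filter
open scoped ENNReal BigOperators
open Literature.Analysis.FluidPDE Literature.MathematicalPhysics.KineticTheory
open Literature.Analysis.FunctionSpaces (Torus.partialDeriv Torus.IsSmooth)

namespace Summit.AtomisticToContinuum.HydrodynamicLimit.Theorems.ClampedTransferCoin

/-! ## Targets: the repaired crux C′ and the momentum rows of the filed crux (anchor) -/

/-- **C′ = `ClampedTransferWindowLD`, typed VERBATIM** (the filed crux with the ONE change `act i := (σ/τ)·collisionSum (Ioc 0 w)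
[c.fst = i] (‖Δv‖ + |‖v⁺‖² − ‖v⁻‖²|/2)`; byte-identical with rchoice Sketch.lean as quoted by the lead, and with the sibling lines'
copies). A LOCAL decl until the tenure planner restates stmt-13733; then `Iff.rfl` against the route decl is the test. -/
def ClampedTransferWindowLD : Prop :=
  ∃ σ₀ : ℝ, 0 < σ₀ ∧ ∀ (a₀ θ₀ : ℝ) (u₀ : Literature.MathematicalPhysics.KineticTheory.V3), 0 < a₀ → 0 < θ₀ → ∀ σ : ℝ, 0 < σ → σ < σ₀ → ∀ Φ : (N : ℕ) → Literature.Analysis.FluidPDE.HardSphereFlow (Literature.Analysis.FluidPDE.Torus.geometry (Fin 3)) (Literature.MathematicalPhysics.KineticTheory.hsDiameter σ N) (N + 1), ∀ φ : Literature.MathematicalPhysics.KineticTheory.T3 → ℝ, Literature.Analysis.FunctionSpaces.Torus.IsSmooth φ → ∃ V₀ : ℝ, 0 < V₀ ∧ ∀ V : ℝ, V₀ ≤ V → ∃ β₀ : ℝ, 0 < β₀ ∧ ∀ β : ℝ, |β| ≤ β₀ → ∀ ε : ℝ, 0 < ε → ∃ τ₀ : ℝ, 0 < τ₀ ∧ ∀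 τ : ℝ, τ₀ ≤ τ → ∃ N₀ : ℕ, ∀ N : ℕ, N₀ ≤ N → (let w : ℝ := τ * ((N : ℝ) + 1) ^ (-(1 / 3 : ℝ)); let P := Literature.MathematicalPhysics.KineticTheory.localGibbsLaw σ (fun _ => a₀) (fun _ => u₀) (fun _ => θ₀) N (Φ N); let Z : ℝ := Literature.MathematicalPhysics.KineticTheory.hsCompressibility (σ ^ 3); let Z' : ℝ := deriv Literature.MathematicalPhysics.KineticTheory.hsCompressibility (σ ^ 3); let act := fun (i : Fin (N + 1)) (z : Literature.Analysis.FluidPDE.Config (N + 1) (Fin 3) Literature.MathematicalPhysics.KineticTheory.T3) => σ / τ * (Φ N).collisionSum (Set.Ioc 0 w) (fun c => if c.fst = i then ‖c.postVel.1 - c.preVel.1‖ + |‖c.postVel.1‖ ^ 2 - ‖c.preVel.1‖ ^ 2| / 2 else 0) z; let ω := fun (i : Fin (N + 1)) (z : Literature.Analysis.FluidPDE.Config (N + 1) (Fin 3) Literature.MathematicalPhysics.KineticTheory.T3) => if act i z ≤ V then (1 : ℝ) else 0; let Xm := fun (k : Fin 3) (z : Literature.Analysis.FluidPDE.Config (N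 + 1) (Fin 3) Literature.MathematicalPhysics.KineticTheory.T3) => (Φ N).collisionSum (Set.Ioc 0 w) (fun c => ω c.fst z * ω c.snd z * ((φ c.fstPos - φ c.sndPos) * (c.postVel.1 k - c.preVel.1 k)) / 2) z; let Am := fun (k : Fin 3) (z : Literature.Analysis.FluidPDE.Config (N + 1) (Fin 3) Literature.MathematicalPhysics.KineticTheory.T3) => ∫ r in (0 : ℝ)..w, ∑ i, Literature.Analysis.FunctionSpaces.Torus.partialDeriv k φ ((Φ N).flow r z i).1 * (θ₀ * σ ^ 3 * Z' + (1 / 3) * (Z - 1) * ‖((Φ N).flow r z i).2 - u₀‖ ^ 2); let Xe := fun (z : Literature.Analysis.FluidPDE.Config (N + 1) (Fin 3) Literature.MathematicalPhysics.KineticTheory.T3) => (Φ N).collisionSum (Set.Ioc 0 w) (fun c => ω c.fst z * ω c.snd z * ((φ c.fstPos - φ c.sndPos) * ((‖c.postVel.1‖ ^ 2 - ‖c.preVel.1‖ ^ 2) / 2)) / 2) z; let Ae := fun (z : Literature.Analysis.FluidPDE.Config (N + 1) (Fin 3) Literature.MathematicalPhysics.KineticTheory.T3) => ∫ r in (0 :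 ℝ)..w, ∑ i, ((∑ l, u₀ l * Literature.Analysis.FunctionSpaces.Torus.partialDeriv l φ ((Φ N).flow r z i).1) * (θ₀ * σ ^ 3 * Z' + (1 / 3) * (Z - 1) * ‖((Φ N).flow r z i).2 - u₀‖ ^ 2) + θ₀ * (Z - 1) * (∑ l, Literature.Analysis.FunctionSpaces.Torus.partialDeriv l φ ((Φ N).flow r z i).1 * (((Φ N).flow r z i).2 - u₀) l)); (∀ k : Fin 3, ∫⁻ z, ENNReal.ofReal (Real.exp (β * (w⁻¹ * Xm k z - w⁻¹ * Am k z))) ∂P ≤ ENNReal.ofReal (Real.exp (ε * ((N : ℝ) + 1)))) ∧ ∫⁻ z, ENNReal.ofReal (Real.exp (β * (w⁻¹ * Xe z - w⁻¹ * Ae z))) ∂P ≤ ENNReal.ofReal (Real.exp (ε * ((N : ℝ) + 1))))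

/-- `ClampedTransferWindowLD` in the named objects of this file (definitional — the dictionary test). -/
theorem clampedTransferWindowLD_iff :
    ClampedTransferWindowLD ↔
      ∃ σ₀ : ℝ, 0 < σ₀ ∧ ∀ (a₀ θ₀ : ℝ) (u₀ : V3), 0 < a₀ → 0 < θ₀ → ∀ σ : ℝ, 0 < σ → σ < σ₀ →
        ∀ Φ : (N : ℕ) → Flow σ N, ∀ φ : T3 → ℝ, Torus.IsSmooth φ → ∃ V₀ : ℝ, 0 < V₀ ∧ ∀ V : ℝ, V₀ ≤ V →
          ∃ β₀ : ℝ, 0 < β₀ ∧ ∀ β : ℝ, |β| ≤ β₀ → ∀ ε : ℝ, 0 < ε → ∃ τ₀ : ℝ, 0 < τ₀ ∧ ∀ τ : ℝ, τ₀ ≤ τ →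
            ∃ N₀ : ℕ, ∀ N : ℕ, N₀ ≤ N →
              (∀ k : Fin 3,
                ∫⁻ z, ENNReal.ofReal (Real.exp (β * ((window τ N)⁻¹ * Xrow σ τ V φ (Φ N) (some k) z -
                    (window τ N)⁻¹ * Arow σ θ₀ u₀ τ φ (Φ N) (some k) z))) ∂(gibbs σ a₀ θ₀ u₀ N (Φ N)) ≤
                  ENNReal.ofReal (Real.exp (ε * ((N : ℝ) + 1)))) ∧
              ∫⁻ z, ENNReal.ofReal (Real.exp (β * ((window τ N)⁻¹ * Xrow σ τ V φ (Φ N) none z -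
                  (window τ N)⁻¹ * Arow σ θ₀ u₀ τ φ (Φ N) none z))) ∂(gibbs σ a₀ θ₀ u₀ N (Φ N)) ≤
                ENNReal.ofReal (Real.exp (ε * ((N : ℝ) + 1))) :=
  Iff.rfl

/-! ## The four large-deviation stubs of the line, as named hypotheses (registered signatures verbatim) -/

/-- S3 `stub_activityOverflowLD` (registered; OPEN): under the canonical Gibbs law the NUMBER of particles whose window transfer
activity exceeds `V` has vanishing per-particle exponential-moment rate at amplitudes `s ≤ s₀(V)` (droplet/cage entropy + a tagged-particle
transfer-activity law of large numbers over kinetic windows, uniformly in `N`). -/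
def ActivityOverflowLD : Prop :=
  ∃ σ₀ : ℝ, 0 < σ₀ ∧ ∀ (a₀ θ₀ : ℝ) (u₀ : V3), 0 < a₀ → 0 < θ₀ → ∀ σ : ℝ, 0 < σ → σ < σ₀ →
      ∀ Φ : (N : ℕ) → Flow σ N, ∃ V₀ : ℝ, 0 < V₀ ∧ ∀ V : ℝ, V₀ ≤ V → ∃ s₀ : ℝ, 0 < s₀ ∧
        ∀ s : ℝ, 0 ≤ s → s ≤ s₀ → ∀ ε : ℝ, 0 < ε → ∃ τ₀ : ℝ, 0 < τ₀ ∧ ∀ τ : ℝ, τ₀ ≤ τ →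
          ∃ N₀ : ℕ, ∀ N : ℕ, N₀ ≤ N →
            AEMeasurable (fun z => (overflowCount σ τ V (Φ N) z : ℝ)) (gibbs σ a₀ θ₀ u₀ N (Φ N)) ∧
            ∫⁻ z, ENNReal.ofReal (Real.exp (s * (overflowCount σ τ V (Φ N) z : ℝ))) ∂(gibbs σ a₀ θ₀ u₀ N (Φ N)) ≤
              ENNReal.ofReal (Real.exp (ε * ((N : ℝ) + 1)))

/-- S4 `stub_coinBudgetLD` (registered; OPEN): the random Hoeffding budget of the coin innovations over the truncated predictable
ranges has vanishing window pressure for `t ≤ t₀(V, L)`. -/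
def CoinBudgetLD : Prop :=
  ∃ σ₀ : ℝ, 0 < σ₀ ∧ ∀ (a₀ θ₀ : ℝ) (u₀ : V3), 0 < a₀ → 0 < θ₀ → ∀ σ : ℝ, 0 < σ → σ < σ₀ →
      ∀ Φ : (N : ℕ) → Flow σ N, ∀ L : ℝ, 0 < L → ∃ V₀ : ℝ, 0 < V₀ ∧ ∀ V : ℝ, V₀ ≤ V → ∃ t₀ : ℝ, 0 < t₀ ∧
        ∀ t : ℝ, 0 ≤ t → t ≤ t₀ → ∀ ε : ℝ, 0 < ε → ∃ τ₀ : ℝ, 0 < τ₀ ∧ ∀ τ : ℝ, τ₀ ≤ τ →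
          ∃ N₀ : ℕ, ∀ N : ℕ, N₀ ≤ N → ∀ (H : ℕ) (r : Option (Fin 3)),
            ∫⁻ z, ENNReal.ofReal (Real.exp (∑ n ∈ Finset.range H,
                min (32 * (t * L) ^ 2 * ((window τ N)⁻¹ * coinRange σ τ V (Φ N) r n z) ^ 2)
                  (16 * (t * L) * ((window τ N)⁻¹ * coinRange σ τ V (Φ N) r n z)))) ∂(gibbs σ a₀ θ₀ u₀ N (Φ N)) ≤
              ENNReal.ofReal (Real.exp (ε * ((N : ℝ) + 1)))

/-- S5 `stub_compensatorDefectLD` (registered; OPEN — the line's bet): along SOME coin filtration the non-innovation part of the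
adapted-clamped transfer is LD-close to the explicit predictable compensator. -/
def CompensatorDefectLD : Prop :=
  ∃ σ₀ : ℝ, 0 < σ₀ ∧ ∀ (a₀ θ₀ : ℝ) (u₀ : V3), 0 < a₀ → 0 < θ₀ → ∀ σ : ℝ, 0 < σ → σ < σ₀ →
      ∀ Φ : (N : ℕ) → Flow σ N, ∀ φ : T3 → ℝ, Torus.IsSmooth φ → ∃ V₀ : ℝ, 0 < V₀ ∧ ∀ V : ℝ, V₀ ≤ V →
        ∃ p₀ : ℝ, 0 < p₀ ∧ ∀ p : ℝ, |p| ≤ p₀ → ∀ ε : ℝ, 0 < ε → ∃ τ₀ : ℝ, 0 < τ₀ ∧ ∀ τ : ℝ, τ₀ ≤ τ →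
          ∃ N₀ : ℕ, ∀ N : ℕ, N₀ ≤ N →
            ∃ (ℱ : Filtration ℕ (inferInstance : MeasurableSpace (Phase N))) (H : ℕ),
              (∀ (r : Option (Fin 3)) (n : ℕ), StronglyMeasurable[ℱ (n + 1)] (coinMark σ τ V φ (Φ N) r n)) ∧
              (∀ (r : Option (Fin 3)) (n : ℕ), StronglyMeasurable[ℱ n] (coinRange σ τ V (Φ N) r n)) ∧
              ∀ r : Option (Fin 3),
                AEMeasurable (fun z => Xa σ τ V φ (Φ N) r z - innov σ a₀ θ₀ u₀ τ V φ (Φ N) ℱ r H z -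
                  Kexp σ τ V φ (Φ N) r z) (gibbs σ a₀ θ₀ u₀ N (Φ N)) ∧
                ∫⁻ z, ENNReal.ofReal (Real.exp (p * ((window τ N)⁻¹ *
                    (Xa σ τ V φ (Φ N) r z - innov σ a₀ θ₀ u₀ τ V φ (Φ N) ℱ r H z - Kexp σ τ V φ (Φ N) r z))))
                    ∂(gibbs σ a₀ θ₀ u₀ N (Φ N)) ≤
                  ENNReal.ofReal (Real.exp (ε * ((N : ℝ) + 1)))

/-- S6 `stub_rateWindowLD` (registered; OPEN — hardest): the explicit predictable compensator is LD-close to the virial EOS projection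
(clamped weighted collision RATES and partner selection at fixed small density). -/
def RateWindowLD : Prop :=
  ∃ σ₀ : ℝ, 0 < σ₀ ∧ ∀ (a₀ θ₀ : ℝ) (u₀ : V3), 0 < a₀ → 0 < θ₀ → ∀ σ : ℝ, 0 < σ → σ < σ₀ →
      ∀ Φ : (N : ℕ) → Flow σ N, ∀ φ : T3 → ℝ, Torus.IsSmooth φ → ∃ V₀ : ℝ, 0 < V₀ ∧ ∀ V : ℝ, V₀ ≤ V →
        ∃ p₀ : ℝ, 0 < p₀ ∧ ∀ p : ℝ, |p| ≤ p₀ → ∀ ε : ℝ, 0 < ε → ∃ τ₀ : ℝ, 0 < τ₀ ∧ ∀ τ : ℝ, τ₀ ≤ τ →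
          ∃ N₀ : ℕ, ∀ N : ℕ, N₀ ≤ N → ∀ r : Option (Fin 3),
            ∫⁻ z, ENNReal.ofReal (Real.exp (p * ((window τ N)⁻¹ *
                (Kexp σ τ V φ (Φ N) r z - Arow σ θ₀ u₀ τ φ (Φ N) r z)))) ∂(gibbs σ a₀ θ₀ u₀ N (Φ N)) ≤
              ENNReal.ofReal (Real.exp (ε * ((N : ℝ) + 1)))

/-! ## Composition: the four LD hypotheses and the two landed stubs imply C′ -/

section Composition

/-- Four-term exponential convexity: `exp(∑ xⱼ) ≤ 4⁻¹ ∑ exp(4 xⱼ)`. -/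
theorem exp_sum_four_le (x : Fin 4 → ℝ) :
    Real.exp (∑ i, x i) ≤ 4⁻¹ * ∑ i, Real.exp (4 * x i) := by
  have h := (convexOn_exp).map_sum_le (t := (Finset.univ : Finset (Fin 4)))
    (w := fun _ => (4⁻¹ : ℝ)) (p := fun i => 4 * x i) (fun _ _ => by positivity)
    (by norm_num [Finset.sum_const, Finset.card_univ]) (fun _ _ => Set.mem_univ _)
  simp only [smul_eq_mul] at h
  have e1 : ∑ i : Fin 4, (4⁻¹ : ℝ) * (4 * x i) = ∑ i, x i :=
    Finset.sum_congr rfl fun i _ => by ring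
  rw [e1, ← Finset.mul_sum] at h
  exact h

/-- `exp(x₁ + x₂ + x₃ + x₄) ≤ 4⁻¹ (exp 4x₁ + exp 4x₂ + exp 4x₃ + exp 4x₄)`. -/
theorem exp_add_four_le (x₁ x₂ x₃ x₄ : ℝ) :
    Real.exp (x₁ + x₂ + x₃ + x₄) ≤
      4⁻¹ * (Real.exp (4 * x₁) + Real.exp (4 * x₂) + Real.exp (4 * x₃) + Real.exp (4 * x₄)) := by
  have h := exp_sum_four_le ![x₁, x₂, x₃, x₄]
  simp only [Fin.sum_univ_four] at h
  simpa [add_assoc] using h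

/-- Measurability of the innovation sum along a filtration carrying the marks. -/
theorem measurable_innov {σ a₀ θ₀ : ℝ} {u₀ : V3} {τ V : ℝ} {φ : T3 → ℝ} {N : ℕ} (Φ : Flow σ N)
    (ℱ : Filtration ℕ (inferInstance : MeasurableSpace (Phase N))) (r : Option (Fin 3)) (H : ℕ)
    (hT : ∀ n : ℕ, StronglyMeasurable[ℱ (n + 1)] (coinMark σ τ V φ Φ r n)) :
    Measurable (innov σ a₀ θ₀ u₀ τ V φ Φ ℱ r H) := by
  unfold innov
  refine Finset.measurable_sum _ fun n _ => ?_
  exact ((hT n).mono (ℱ.le (n + 1))).measurable.sub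
    (stronglyMeasurable_condExp.mono (ℱ.le n)).measurable

variable {σ a₀ θ₀ : ℝ} {u₀ : V3} {N : ℕ}

/-- The assembly at fixed `N`, `Φ`, row `r`: the identity
`β w⁻¹(X - A) = β w⁻¹(X - X̃) + β w⁻¹ M_H + β w⁻¹(X̃ - M_H - K_exp) + β w⁻¹(K_exp - A)`, the overflow bound on the first piece,
four-term exponential convexity at tilt `4`, and the four pressure bounds. -/
theorem assemble (Φ : Flow σ N) {τ V L β ε : ℝ} {φ : T3 → ℝ} {r : Option (Fin 3)}
    (ℱ : Filtration ℕ (inferInstance : MeasurableSpace (Phase N))) (H : ℕ)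
    (hτ : 0 < τ)
    (hgood : ∀ᵐ z ∂(gibbs σ a₀ θ₀ u₀ N Φ), z ∈ Φ.good)
    (hClamp : ∀ z ∈ Φ.good, |Xrow σ τ V φ Φ r z - Xa σ τ V φ Φ r z| ≤
      window τ N * L * V * (overflowCount σ τ V Φ z : ℝ))
    (hCm : AEMeasurable (fun z => (overflowCount σ τ V Φ z : ℝ)) (gibbs σ a₀ θ₀ u₀ N Φ))
    (hC : ∫⁻ z, ENNReal.ofReal (Real.exp (4 * |β| * L * V * (overflowCount σ τ V Φ z : ℝ)))
      ∂(gibbs σ a₀ θ₀ u₀ N Φ) ≤ ENNReal.ofReal (Real.exp (ε * ((N : ℝ) + 1))))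
    (hMm : Measurable (innov σ a₀ θ₀ u₀ τ V φ Φ ℱ r H))
    (hM : ∫⁻ z, ENNReal.ofReal (Real.exp (8 * β * (window τ N)⁻¹ / 2 * innov σ a₀ θ₀ u₀ τ V φ Φ ℱ r H z))
      ∂(gibbs σ a₀ θ₀ u₀ N Φ) ≤ ENNReal.ofReal (Real.exp (ε * ((N : ℝ) + 1))))
    (hDm : AEMeasurable (fun z => Xa σ τ V φ Φ r z - innov σ a₀ θ₀ u₀ τ V φ Φ ℱ r H z - Kexp σ τ V φ Φ r z)
      (gibbs σ a₀ θ₀ u₀ N Φ))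
    (hD : ∫⁻ z, ENNReal.ofReal (Real.exp (4 * β * ((window τ N)⁻¹ *
        (Xa σ τ V φ Φ r z - innov σ a₀ θ₀ u₀ τ V φ Φ ℱ r H z - Kexp σ τ V φ Φ r z))))
      ∂(gibbs σ a₀ θ₀ u₀ N Φ) ≤ ENNReal.ofReal (Real.exp (ε * ((N : ℝ) + 1))))
    (hR : ∫⁻ z, ENNReal.ofReal (Real.exp (4 * β * ((window τ N)⁻¹ *
        (Kexp σ τ V φ Φ r z - Arow σ θ₀ u₀ τ φ Φ r z)))) ∂(gibbs σ a₀ θ₀ u₀ N Φ) ≤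
      ENNReal.ofReal (Real.exp (ε * ((N : ℝ) + 1)))) :
    ∫⁻ z, ENNReal.ofReal (Real.exp (β * ((window τ N)⁻¹ * Xrow σ τ V φ Φ r z -
        (window τ N)⁻¹ * Arow σ θ₀ u₀ τ φ Φ r z))) ∂(gibbs σ a₀ θ₀ u₀ N Φ) ≤
      ENNReal.ofReal (Real.exp (ε * ((N : ℝ) + 1))) := by
  set G := gibbs σ a₀ θ₀ u₀ N Φ with hG
  set w := window τ N with hw
  have hwpos : 0 < w := window_pos hτ N
  -- the four integrands
  set F₁ : Phase N → ℝ≥0∞ := fun z =>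
    ENNReal.ofReal (Real.exp (4 * |β| * L * V * (overflowCount σ τ V Φ z : ℝ))) with hF₁
  set F₂ : Phase N → ℝ≥0∞ := fun z =>
    ENNReal.ofReal (Real.exp (8 * β * w⁻¹ / 2 * innov σ a₀ θ₀ u₀ τ V φ Φ ℱ r H z)) with hF₂
  set F₃ : Phase N → ℝ≥0∞ := fun z =>
    ENNReal.ofReal (Real.exp (4 * β * (w⁻¹ *
      (Xa σ τ V φ Φ r z - innov σ a₀ θ₀ u₀ τ V φ Φ ℱ r H z - Kexp σ τ V φ Φ r z)))) with hF₃
  set F₄ : Phase N → ℝ≥0∞ := fun z =>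
    ENNReal.ofReal (Real.exp (4 * β * (w⁻¹ * (Kexp σ τ V φ Φ r z - Arow σ θ₀ u₀ τ φ Φ r z)))) with hF₄
  -- pointwise bound, almost everywhere (on the good set)
  have hpt : ∀ᵐ z ∂G, ENNReal.ofReal (Real.exp (β * (w⁻¹ * Xrow σ τ V φ Φ r z - w⁻¹ * Arow σ θ₀ u₀ τ φ Φ r z))) ≤
      ENNReal.ofReal 4⁻¹ * (F₁ z + F₂ z + F₃ z + F₄ z) := by
    filter_upwards [hgood] with z hz
    have hCl := hClamp z hz
    set X := Xrow σ τ V φ Φ r z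
    set Xt := Xa σ τ V φ Φ r z
    set M := innov σ a₀ θ₀ u₀ τ V φ Φ ℱ r H z
    set K := Kexp σ τ V φ Φ r z
    set A := Arow σ θ₀ u₀ τ φ Φ r z
    set c : ℝ := (overflowCount σ τ V Φ z : ℝ)
    have hc : 0 ≤ c := Nat.cast_nonneg _
    -- the first piece is carried by the overflowing particles
    have h1 : β * (w⁻¹ * (X - Xt)) ≤ |β| * L * V * c := by
      have e1 : β * (w⁻¹ * (X - Xt)) ≤ |β| * (w⁻¹ * |X - Xt|) := by
        calc β * (w⁻¹ * (X - Xt)) ≤ |β * (w⁻¹ * (X - Xt))| := le_abs_self _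
          _ = |β| * (w⁻¹ * |X - Xt|) := by
              rw [abs_mul, abs_mul, abs_of_pos (inv_pos.2 hwpos)]
      have e2 : w⁻¹ * |X - Xt| ≤ w⁻¹ * (w * L * V * c) :=
        mul_le_mul_of_nonneg_left hCl (inv_pos.2 hwpos).le
      have e3 : w⁻¹ * (w * L * V * c) = L * V * c := by
        field_simp
      calc β * (w⁻¹ * (X - Xt)) ≤ |β| * (w⁻¹ * |X - Xt|) := e1
        _ ≤ |β| * (w⁻¹ * (w * L * V * c)) := mul_le_mul_of_nonneg_left e2 (abs_nonneg β)
        _ = |β| * L * V * c := by rw [e3]; ring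
    -- the exact four-way split
    have hid : β * (w⁻¹ * X - w⁻¹ * A) =
        β * (w⁻¹ * (X - Xt)) + (8 * β * w⁻¹ / 2 * M) / 4 +
        (4 * β * (w⁻¹ * (Xt - M - K))) / 4 + (4 * β * (w⁻¹ * (K - A))) / 4 := by
      ring
    have step : Real.exp (β * (w⁻¹ * X - w⁻¹ * A)) ≤
        Real.exp (|β| * L * V * c + (8 * β * w⁻¹ / 2 * M) / 4 +
          (4 * β * (w⁻¹ * (Xt - M - K))) / 4 + (4 * β * (w⁻¹ * (K - A))) / 4) := by
      rw [Real.exp_le_exp, hid]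
      linarith
    have hreal : Real.exp (β * (w⁻¹ * X - w⁻¹ * A)) ≤
        4⁻¹ * (Real.exp (4 * |β| * L * V * c) + Real.exp (8 * β * w⁻¹ / 2 * M) +
          Real.exp (4 * β * (w⁻¹ * (Xt - M - K))) + Real.exp (4 * β * (w⁻¹ * (K - A)))) := by
      refine step.trans ?_
      refine (exp_add_four_le _ _ _ _).trans (le_of_eq ?_)
      have q1 : 4 * (|β| * L * V * c) = 4 * |β| * L * V * c := by ring
      have q2 : 4 * (8 * β * w⁻¹ / 2 * M / 4) = 8 * β * w⁻¹ / 2 * M := by ring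
      have q3 : 4 * (4 * β * (w⁻¹ * (Xt - M - K)) / 4) = 4 * β * (w⁻¹ * (Xt - M - K)) := by ring
      have q4 : 4 * (4 * β * (w⁻¹ * (K - A)) / 4) = 4 * β * (w⁻¹ * (K - A)) := by ring
      rw [q1, q2, q3, q4]
    have hnn : ∀ x : ℝ, 0 ≤ Real.exp x := fun x => (Real.exp_pos x).le
    calc ENNReal.ofReal (Real.exp (β * (w⁻¹ * X - w⁻¹ * A)))
        ≤ ENNReal.ofReal (4⁻¹ * (Real.exp (4 * |β| * L * V * c) + Real.exp (8 * β * w⁻¹ / 2 * M) +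
          Real.exp (4 * β * (w⁻¹ * (Xt - M - K))) + Real.exp (4 * β * (w⁻¹ * (K - A))))) :=
          ENNReal.ofReal_le_ofReal hreal
      _ = ENNReal.ofReal 4⁻¹ * (F₁ z + F₂ z + F₃ z + F₄ z) := by
          simp only [hF₁, hF₂, hF₃, hF₄]
          rw [ENNReal.ofReal_mul (by norm_num), ENNReal.ofReal_add (by positivity) (hnn _),
            ENNReal.ofReal_add (by positivity) (hnn _), ENNReal.ofReal_add (hnn _) (hnn _)]
  -- measurability of the integrands
  have hm₁ : AEMeasurable F₁ G :=
    ENNReal.measurable_ofReal.comp_aemeasurable (Real.measurable_exp.comp_aemeasurable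
      (hCm.const_mul (4 * |β| * L * V)))
  have hm₂ : AEMeasurable F₂ G :=
    ENNReal.measurable_ofReal.comp_aemeasurable (Real.measurable_exp.comp_aemeasurable
      ((hMm.aemeasurable (μ := G)).const_mul (8 * β * w⁻¹ / 2)))
  have hm₃ : AEMeasurable F₃ G :=
    ENNReal.measurable_ofReal.comp_aemeasurable (Real.measurable_exp.comp_aemeasurable
      ((hDm.const_mul w⁻¹).const_mul (4 * β)))
  have hm₁₂ : AEMeasurable (fun z => F₁ z + F₂ z) G := hm₁.add hm₂
  have hm₁₂₃ : AEMeasurable (fun z => F₁ z + F₂ z + F₃ z) G := hm₁₂.add hm₃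
  -- integrate
  have hsplit : ∫⁻ z, (F₁ z + F₂ z + F₃ z + F₄ z) ∂G =
      ∫⁻ z, F₁ z ∂G + ∫⁻ z, F₂ z ∂G + ∫⁻ z, F₃ z ∂G + ∫⁻ z, F₄ z ∂G := by
    rw [lintegral_add_left' hm₁₂₃, lintegral_add_left' hm₁₂, lintegral_add_left' hm₁]
  set B : ℝ≥0∞ := ENNReal.ofReal (Real.exp (ε * ((N : ℝ) + 1))) with hB
  have h4 : ∫⁻ z, (F₁ z + F₂ z + F₃ z + F₄ z) ∂G ≤ 4 * B := by
    rw [hsplit]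
    calc ∫⁻ z, F₁ z ∂G + ∫⁻ z, F₂ z ∂G + ∫⁻ z, F₃ z ∂G + ∫⁻ z, F₄ z ∂G
        ≤ B + B + B + B := by gcongr
      _ = 4 * B := by ring
  calc ∫⁻ z, ENNReal.ofReal (Real.exp (β * (w⁻¹ * Xrow σ τ V φ Φ r z - w⁻¹ * Arow σ θ₀ u₀ τ φ Φ r z))) ∂G
      ≤ ∫⁻ z, ENNReal.ofReal 4⁻¹ * (F₁ z + F₂ z + F₃ z + F₄ z) ∂G := lintegral_mono_ae hpt
    _ = ENNReal.ofReal 4⁻¹ * ∫⁻ z, (F₁ z + F₂ z + F₃ z + F₄ z) ∂G :=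
        lintegral_const_mul' _ _ ENNReal.ofReal_ne_top
    _ ≤ ENNReal.ofReal 4⁻¹ * (4 * B) := by gcongr
    _ = B := by
        rw [← mul_assoc, ← ENNReal.ofReal_ofNat 4, ← ENNReal.ofReal_mul (by norm_num)]
        norm_num

/-- **The composition: the four LD hypotheses (with the landed S1, S2) imply the repaired crux C′ (all four rows).**
A conditional result (registered sub-goal of the line). -/
theorem clampedTransferWindowLD_of_LD (h3 : ActivityOverflowLD) (h4 : CoinBudgetLD) (h5 : CompensatorDefectLD)
    (h6 : RateWindowLD) : ClampedTransferWindowLD := by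
  rw [clampedTransferWindowLD_iff]
  obtain ⟨σ₃, hσ₃, hS3⟩ := h3
  obtain ⟨σ₄, hσ₄, hS4⟩ := h4
  obtain ⟨σ₅, hσ₅, hS5⟩ := h5
  obtain ⟨σ₆, hσ₆, hS6⟩ := h6
  refine ⟨min (min σ₃ σ₄) (min (min σ₅ σ₆) (1 / 2)),
    lt_min (lt_min hσ₃ hσ₄) (lt_min (lt_min hσ₅ hσ₆) (by norm_num)), ?_⟩
  intro a₀ θ₀ u₀ ha hθ σ hσ hσlt Φ φ hφ
  have hσ₃' : σ < σ₃ := hσlt.trans_le ((min_le_left _ _).trans (min_le_left _ _))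
  have hσ₄' : σ < σ₄ := hσlt.trans_le ((min_le_left _ _).trans (min_le_right _ _))
  have hσ₅' : σ < σ₅ := hσlt.trans_le ((min_le_right _ _).trans ((min_le_left _ _).trans (min_le_left _ _)))
  have hσ₆' : σ < σ₆ := hσlt.trans_le ((min_le_right _ _).trans ((min_le_left _ _).trans (min_le_right _ _)))
  have hσhalf : σ < 1 / 2 := hσlt.trans_le ((min_le_right _ _).trans (min_le_right _ _))
  have hσ2 : σ ≤ 1 / 2 := hσhalf.le
  -- S2: a Lipschitz constant of `φ`
  obtain ⟨L, hL, hS2⟩ := stub_adaptedClampKinematics φ hφ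
  -- the budget threshold `V₀`
  obtain ⟨V₃, hV₃, hS3⟩ := hS3 a₀ θ₀ u₀ ha hθ σ hσ hσ₃' Φ
  obtain ⟨V₄, hV₄, hS4⟩ := hS4 a₀ θ₀ u₀ ha hθ σ hσ hσ₄' Φ L hL
  obtain ⟨V₅, hV₅, hS5⟩ := hS5 a₀ θ₀ u₀ ha hθ σ hσ hσ₅' Φ φ hφ
  obtain ⟨V₆, hV₆, hS6⟩ := hS6 a₀ θ₀ u₀ ha hθ σ hσ hσ₆' Φ φ hφ
  refine ⟨max (max V₃ V₄) (max V₅ V₆), lt_max_of_lt_left (lt_max_of_lt_left hV₃), fun V hV => ?_⟩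
  have hV3 : V₃ ≤ V := ((le_max_left _ _).trans (le_max_left _ _)).trans hV
  have hV4 : V₄ ≤ V := ((le_max_right _ _).trans (le_max_left _ _)).trans hV
  have hV5 : V₅ ≤ V := ((le_max_left _ _).trans (le_max_right _ _)).trans hV
  have hV6 : V₆ ≤ V := ((le_max_right _ _).trans (le_max_right _ _)).trans hV
  have hVpos : 0 < V := hV₃.trans_le hV3
  obtain ⟨s₀, hs₀, hS3⟩ := hS3 V hV3
  obtain ⟨t₀, ht₀, hS4⟩ := hS4 V hV4
  obtain ⟨p₅, hp₅, hS5⟩ := hS5 V hV5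
  obtain ⟨p₆, hp₆, hS6⟩ := hS6 V hV6
  -- the amplitude threshold `β₀`
  have hLV : 0 < 4 * L * V := by positivity
  refine ⟨min (min (s₀ / (4 * L * V)) t₀) (min (p₅ / 4) (p₆ / 4)),
    lt_min (lt_min (div_pos hs₀ hLV) ht₀) (lt_min (by positivity) (by positivity)), fun β hβ ε hε => ?_⟩
  have hβs : 4 * |β| * L * V ≤ s₀ := by
    have h1 : |β| ≤ s₀ / (4 * L * V) := hβ.trans ((min_le_left _ _).trans (min_le_left _ _))
    have h2 := (le_div_iff₀ hLV).1 h1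
    linarith
  have hβt : |β| ≤ t₀ := hβ.trans ((min_le_left _ _).trans (min_le_right _ _))
  have hβ5 : |4 * β| ≤ p₅ := by
    have h1 : |β| ≤ p₅ / 4 := hβ.trans ((min_le_right _ _).trans (min_le_left _ _))
    rw [abs_mul, abs_of_pos (by norm_num : (0 : ℝ) < 4)]
    linarith
  have hβ6 : |4 * β| ≤ p₆ := by
    have h1 : |β| ≤ p₆ / 4 := hβ.trans ((min_le_right _ _).trans (min_le_right _ _))
    rw [abs_mul, abs_of_pos (by norm_num : (0 : ℝ) < 4)]
    linarith
  obtain ⟨τ₃, hτ₃, hS3⟩ := hS3 (4 * |β| * L * V) (by positivity) hβs ε hε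
  obtain ⟨τ₄, hτ₄, hS4⟩ := hS4 |β| (abs_nonneg β) hβt (2 * ε) (by positivity)
  obtain ⟨τ₅, hτ₅, hS5⟩ := hS5 (4 * β) hβ5 ε hε
  obtain ⟨τ₆, hτ₆, hS6⟩ := hS6 (4 * β) hβ6 ε hε
  refine ⟨max (max τ₃ τ₄) (max τ₅ τ₆), lt_max_of_lt_left (lt_max_of_lt_left hτ₃), fun τ hτ => ?_⟩
  have hτ3 : τ₃ ≤ τ := ((le_max_left _ _).trans (le_max_left _ _)).trans hτ
  have hτ4 : τ₄ ≤ τ := ((le_max_right _ _).trans (le_max_left _ _)).trans hτ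
  have hτ5 : τ₅ ≤ τ := ((le_max_left _ _).trans (le_max_right _ _)).trans hτ
  have hτ6 : τ₆ ≤ τ := ((le_max_right _ _).trans (le_max_right _ _)).trans hτ
  have hτpos : 0 < τ := hτ₃.trans_le hτ3
  obtain ⟨N₃, hN₃⟩ := hS3 τ hτ3
  obtain ⟨N₄, hN₄⟩ := hS4 τ hτ4
  obtain ⟨N₅, hN₅⟩ := hS5 τ hτ5
  obtain ⟨N₆, hN₆⟩ := hS6 τ hτ6
  refine ⟨max (max N₃ N₄) (max N₅ N₆), fun N hN => ?_⟩
  -- fixed `N`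
  have hN3 : N₃ ≤ N := ((le_max_left _ _).trans (le_max_left _ _)).trans hN
  have hN4 : N₄ ≤ N := ((le_max_right _ _).trans (le_max_left _ _)).trans hN
  have hN5 : N₅ ≤ N := ((le_max_left _ _).trans (le_max_right _ _)).trans hN
  have hN6 : N₆ ≤ N := ((le_max_right _ _).trans (le_max_right _ _)).trans hN
  haveI : IsProbabilityMeasure (gibbs σ a₀ θ₀ u₀ N (Φ N)) :=
    isProbabilityMeasure_localGibbsLaw continuous_const continuous_const continuous_const
      (fun _ => ha) (fun _ => hθ) hσ2 N (Φ N)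
  obtain ⟨hCm, hC⟩ := hN₃ N hN3
  obtain ⟨ℱ, H, hTmeas, hRmeas, hS5r⟩ := hN₅ N hN5
  have hwpos : 0 < window τ N := window_pos hτpos N
  have hγabs : |8 * β * (window τ N)⁻¹| = 8 * |β| * (window τ N)⁻¹ := by
    rw [abs_mul, abs_mul, abs_inv, abs_of_pos hwpos, abs_of_pos (by norm_num : (0 : ℝ) < 8)]
  -- every row `r`
  have hrow : ∀ r : Option (Fin 3),
      ∫⁻ z, ENNReal.ofReal (Real.exp (β * ((window τ N)⁻¹ * Xrow σ τ V φ (Φ N) r z -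
          (window τ N)⁻¹ * Arow σ θ₀ u₀ τ φ (Φ N) r z))) ∂(gibbs σ a₀ θ₀ u₀ N (Φ N)) ≤
        ENNReal.ofReal (Real.exp (ε * ((N : ℝ) + 1))) := by
    intro r
    obtain ⟨hDm, hD⟩ := hS5r r
    have hR := hN₆ N hN6 r
    have hbudget := hN₄ N hN4 H r
    obtain ⟨hS2a, hS2b, hS2c⟩ := hS2 σ τ V hσ hσhalf hτpos hVpos.le N (Φ N) r
    -- S1 along the filtration delivered by S5, with the budget of S4
    have hbudget' : ∫⁻ z, ENNReal.ofReal (Real.exp (∑ n ∈ Finset.range H,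
        min ((8 * β * (window τ N)⁻¹) ^ 2 * (L * coinRange σ τ V (Φ N) r n z) ^ 2 / 2)
          (2 * |8 * β * (window τ N)⁻¹| * (L * coinRange σ τ V (Φ N) r n z)))) ∂(gibbs σ a₀ θ₀ u₀ N (Φ N)) ≤
        ENNReal.ofReal (Real.exp (2 * (ε * ((N : ℝ) + 1)))) := by
      have e : ∀ z : Phase N, (∑ n ∈ Finset.range H,
          min ((8 * β * (window τ N)⁻¹) ^ 2 * (L * coinRange σ τ V (Φ N) r n z) ^ 2 / 2)
            (2 * |8 * β * (window τ N)⁻¹| * (L * coinRange σ τ V (Φ N) r n z))) =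
          ∑ n ∈ Finset.range H,
            min (32 * (|β| * L) ^ 2 * ((window τ N)⁻¹ * coinRange σ τ V (Φ N) r n z) ^ 2)
              (16 * (|β| * L) * ((window τ N)⁻¹ * coinRange σ τ V (Φ N) r n z)) := by
        intro z
        refine Finset.sum_congr rfl fun n _ => ?_
        have h1 : (8 * β * (window τ N)⁻¹) ^ 2 * (L * coinRange σ τ V (Φ N) r n z) ^ 2 / 2 =
            32 * (|β| * L) ^ 2 * ((window τ N)⁻¹ * coinRange σ τ V (Φ N) r n z) ^ 2 := by
          simp only [mul_pow, sq_abs]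
          ring
        have h2 : 2 * |8 * β * (window τ N)⁻¹| * (L * coinRange σ τ V (Φ N) r n z) =
            16 * (|β| * L) * ((window τ N)⁻¹ * coinRange σ τ V (Φ N) r n z) := by
          rw [hγabs]
          ring
        rw [h1, h2]
      simp_rw [e]
      have e2 : 2 * (ε * ((N : ℝ) + 1)) = 2 * ε * ((N : ℝ) + 1) := by ring
      rw [e2]
      exact hbudget
    have hM := stub_predictableHoeffdingChain (gibbs σ a₀ θ₀ u₀ N (Φ N)) ℱ
      (fun n => coinMark σ τ V φ (Φ N) r n) (fun n z => L * coinRange σ τ V (Φ N) r n z)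
      (window τ N * L * V) (hTmeas r) (fun n => (hRmeas r n).const_mul L)
      (fun n z => hS2b n z) (fun n z => hS2c n z) H (8 * β * (window τ N)⁻¹) (ε * ((N : ℝ) + 1)) hbudget'
    exact assemble (Φ N) ℱ H hτpos
      (ae_mem_good_localGibbsLaw σ (fun _ => a₀) (fun _ => u₀) (fun _ => θ₀) N (Φ N))
      hS2a hCm hC (measurable_innov (Φ N) ℱ r H (hTmeas r)) hM hDm hD hR
  exact ⟨fun k => hrow (some k), hrow none⟩

end Composition

end Summit.AtomisticToContinuum.HydrodynamicLimit.Theorems.ClampedTransferCoin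

end
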